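import Literature.Topology.FourManifolds.SphereFourGenusOneSplitting
import Literature.Topology.FourManifolds.RegularLevelMorseData
import Literature.Topology.FourManifolds.LatticeFormsOrthoSumSignature
import Literature.Topology.FourManifolds.CircleProdSumAdditivity
import Literature.Topology.FourManifolds.LevelTranslation
import Literature.Topology.FourManifolds.NiceMorseFunctionsProofs
import HarnessLib

/-!
# The round `S¹ × S³ ⊆ ℝ⁵`: a Morse function of type `(1, 1, 0, 1, 1)`, and `≅ 𝕊¹ × 𝕊³`

Topic `Literature/Topology/FourManifolds`; model input for the genus one base of
Meier–Schirmer–Zupan's classification (`Literature.Topology.FourManifolds.msz_trisection_classification_gk`,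
the `(1; 1, 1, 1)`-trisection of `S¹ × S³`: MSZ 2016, §3 p. 6) through
`FourManifoldsWithoutTwoHandles.lean` (closed oriented `4`-manifolds without `2`-handles and one
`1`-handle are all diffeomorphic, given the `2`-handlebody fact), which needs ONE closed oriented
`4`-manifold known to be `S¹ × S³` and known to carry a handle decomposition `h⁰ ∪ h¹ ∪ h³ ∪ h⁴`
(Kirby 1989, Ch. I §2, p. 8).  Everything here is **proved**; the `def`s are explicit subsets of
`ℝ⁵`, explicit functions and maps; no named fact is introduced.

* §1–§2 **The model** `T = {torusFn = 0} ⊆ ℝ⁵`, `torusFn(p) = (‖p‖² + 3)² - 16 (p₀² + p₁²)` — the set of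
  points at distance `1` from the circle of radius `2` in the `(p₀, p₁)`-plane
  (`‖p‖² + 3 = 4 √(p₀² + p₁²)`) — a regular level (`isRegularLevel_torusFn`), hence a closed smooth
  `4`-manifold `LevelTorus` (`Literature.Topology.FourManifolds.RegularLevel`, charted on `ℝ⁴`),
  compact (`1 ≤ ‖p‖² ≤ 9`).
* §3 **The height `p₀|T` has exactly four critical points** `±e₀`, `±3e₀` (Lagrange:
  `RegularLevel.isMCriticalPt_comp_incl_iff_of_chart` in the identity chart of `ℝ⁵`;
  `eq_axisPt_of_lagrange`).
* §4–§5 **Nondegeneracy and indices** from the restricted Hessian of the ambient function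
  `p₀ - μ torusFn`, `μ = 1/(4s(s² - 5))` at `s e₀` (`RegularLevel.nondegenerate_mhessian_comp_incl_iff`,
  `RegularLevel.morseIndex_comp_incl_eq`): on `ker dTorusFn(s e₀) = {v₀ = 0}` it is
  `diag(-1/s; -(s² + 3)/(s(s² - 5)) (×3))`, of index `0, 1, 3, 4` at `s = -3, 1, -1, 3`
  (Sylvester through the `B`-orthogonal family `e₁, …, e₄`,
  `LinearMap.BilinForm.sigPos_eq_card_of_orthogonal`).
* §6 `isMorse_heightT`, `criticalSetOfIndex_heightT`, `ncard_criticalSetOfIndex_heightT` — **the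
  height is a Morse function on `T` of type `(1, 1, 0, 1, 1)`**.
* §7 **`T ≅ 𝕊¹ × 𝕊³`** (`levelTorusDiffeomorph`, onto Mathlib's product of unit spheres with
  the product model `(𝓡 1).prod (𝓡 3)`; explicit mutually inverse smooth maps
  `p ↦ ((p₀, p₁)/r, (r - 2, p₂, p₃, p₄))`, `(c, u) ↦ ((2 + u₀) c, u₁, u₂, u₃)`), hence
  `T ≅ Circle × 𝕊³` (`nonempty_levelTorusDiffeomorph_circle`) and **`T` is orientable**
  (`isOrientable_levelTorus`, from the tree's orientable recharted copy of `Circle × 𝕊³`,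
  `exists_circleProdSphereThree_euclidean`).
* §8 `exists_isSelfIndexing_levelTorus` — by Milnor's rearrangement theorem (the tree's
  discharged `exists_isSelfIndexing_criticalSet_eq_holds`) **`T` carries a self-indexing Morse
  function of type `(1, 1, 0, 1, 1)`**.

The computations follow the pattern of `SphereFourGenusOneSplitting.lean` (whose calculus on
`ℝ⁵` — `sqNorm`, `dSqNorm`, `π`, `E5`, `refl_mem_maximalAtlas` — is reused from the namespace
`SphereFourSplitting`); the constructions live in the namespace
`Literature.Topology.FourManifolds.RoundCircleProdSphereThree`.

## References

* J. Milnor, *Morse theory*, Ann. of Math. Studies 51 (1963), §2 (nondegenerate critical points,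
  index), Thm. 3.1. [Milnor1963]
* J. Milnor, *Lectures on the h-cobordism theorem* (1965), Thm. 4.8 and Def. 4.9.
  [MilnorHCobordism1965]
* R. C. Kirby, *The topology of 4-manifolds*, LNM 1374 (1989), Ch. I §2, p. 8. [Kirby1989]
* J.-P. Serre, *A Course in Arithmetic* (1973), Ch. IV §2.4 (signature in an orthogonal basis).
  [Serre1973]
* M. W. Hirsch, *Differential Topology* (1976), §4.4 p. 101 (orientability along
  diffeomorphisms). [HirschDT1976]
-/

open scoped Manifold ContDiff Topology
open Set Function Filter Metric Module

noncomputable section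

namespace Literature.Topology.FourManifolds

attribute [local instance] fact_finrank_euclideanSpace_succ

namespace RoundCircleProdSphereThree

open SphereFourSplitting

/-! ### §1 Calculus on `ℝ⁵`: the ring function and the defining function `torusFn` -/

/-- The ring function `r² = p₀² + p₁²` (square distance from the axis `{p₀ = p₁ = 0}`). [folklore] -/
def ringFn (p : (EuclideanSpace ℝ (Fin 5))) : ℝ := p 0 ^ 2 + p 1 ^ 2

/-- `d(r²) = 2 p₀ dp₀ + 2 p₁ dp₁`. [folklore] -/
def dRingFn (p : (EuclideanSpace ℝ (Fin 5))) : ((EuclideanSpace ℝ (Fin 5))) →L[ℝ] ℝ := (2 * p 0) • π 0 + (2 * p 1) • π 1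

/-- `d(r²)(p)` evaluated. [folklore] -/
@[simp] theorem dRingFn_apply (p v : (EuclideanSpace ℝ (Fin 5))) : dRingFn p v = 2 * p 0 * v 0 + 2 * p 1 * v 1 := by
  simp [dRingFn, smul_eq_mul]

/-- `r²` is differentiable with differential `dRingFn`. [folklore] -/
theorem hasFDerivAt_ringFn (p : (EuclideanSpace ℝ (Fin 5))) : HasFDerivAt ringFn (dRingFn p) p := by
  have h := (hasFDerivAt_coord 0 p).pow 2 |>.add ((hasFDerivAt_coord 1 p).pow 2)
  have h' : HasFDerivAt ringFn _ p := h.congr_of_eventuallyEq (Eventually.of_forall fun q => rfl)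
  refine h'.congr_fderiv ?_
  ext v
  simp [dRingFn, smul_eq_mul]

/-- `fderiv (r²) = dRingFn`. [folklore] -/
theorem fderiv_ringFn : fderiv ℝ ringFn = dRingFn := funext fun p => (hasFDerivAt_ringFn p).fderiv

/-- `r²` is smooth. [folklore] -/
theorem contDiff_ringFn : ContDiff ℝ ∞ ringFn := by
  unfold ringFn; fun_prop

/-- **The defining function** `torusFn(p) = (‖p‖² + 3)² - 16 (p₀² + p₁²)`; its zero set is the round
`S¹ × S³` of points at distance `1` from the circle of radius `2` in the `(p₀, p₁)`-plane:
`(√(p₀² + p₁²) - 2)² + p₂² + p₃² + p₄² = 1 ⟺ ‖p‖² + 3 = 4 √(p₀² + p₁²)`. [folklore] -/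
def torusFn (p : (EuclideanSpace ℝ (Fin 5))) : ℝ := (sqNorm p + 3) ^ 2 - 16 * ringFn p

/-- `dTorusFn(p) = 2 (‖p‖² + 3) d(‖p‖²) - 16 d(r²)`. [folklore] -/
def dTorusFn (p : (EuclideanSpace ℝ (Fin 5))) : ((EuclideanSpace ℝ (Fin 5))) →L[ℝ] ℝ := (2 * (sqNorm p + 3)) • dSqNorm p - (16 : ℝ) • dRingFn p

/-- `dTorusFn(p)` evaluated: `(4(N + 3) - 32)(p₀v₀ + p₁v₁) + 4(N + 3)(p₂v₂ + p₃v₃ + p₄v₄)`. [folklore] -/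
theorem dTorusFn_apply (p v : (EuclideanSpace ℝ (Fin 5))) :
    dTorusFn p v = (4 * (sqNorm p + 3) - 32) * (p 0 * v 0 + p 1 * v 1) +
      4 * (sqNorm p + 3) * (p 2 * v 2 + p 3 * v 3 + p 4 * v 4) := by
  simp [dTorusFn, smul_eq_mul]
  ring

/-- `torusFn` is differentiable with differential `dTorusFn`. [folklore] -/
theorem hasFDerivAt_torusFn (p : (EuclideanSpace ℝ (Fin 5))) : HasFDerivAt torusFn (dTorusFn p) p := by
  have h := (((hasFDerivAt_sqNorm p).add_const (3 : ℝ)).pow 2).sub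
    ((hasFDerivAt_ringFn p).const_mul (16 : ℝ))
  have h' : HasFDerivAt torusFn _ p := h.congr_of_eventuallyEq (Eventually.of_forall fun q => by
    simp [torusFn])
  refine h'.congr_fderiv ?_
  ext v
  simp only [dTorusFn, sub_apply, smul_apply, smul_eq_mul, dSqNorm_apply, dRingFn_apply]
  ring

/-- `fderiv torusFn = dTorusFn`. [folklore] -/
theorem fderiv_torusFn : fderiv ℝ torusFn = dTorusFn := funext fun p => (hasFDerivAt_torusFn p).fderiv

/-- `torusFn` is smooth. [folklore] -/
theorem contDiff_torusFn : ContDiff ℝ ∞ torusFn := by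
  unfold torusFn; exact ((contDiff_sqNorm.add contDiff_const).pow 2).sub (contDiff_const.mul contDiff_ringFn)

/-- `r² ≤ ‖p‖²`. [folklore] -/
theorem ringFn_le_sqNorm (p : (EuclideanSpace ℝ (Fin 5))) : ringFn p ≤ sqNorm p := by
  simp only [ringFn, sqNorm]; nlinarith [sq_nonneg (p 2), sq_nonneg (p 3), sq_nonneg (p 4)]

/-- `r² ≥ 0`. [folklore] -/
theorem ringFn_nonneg (p : (EuclideanSpace ℝ (Fin 5))) : 0 ≤ ringFn p := by
  simp only [ringFn]; positivity

/-- `N ≥ 0`. [folklore] -/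
theorem sqNorm_nonneg (p : (EuclideanSpace ℝ (Fin 5))) : 0 ≤ sqNorm p := by
  simp only [sqNorm]; positivity

/-- **On `{torusFn = 0}`: `1 ≤ ‖p‖² ≤ 9`** (`(N + 3)² = 16 r² ≤ 16 N` gives `(N - 1)(N - 9) ≤ 0`).
[folklore] -/
theorem sqNorm_bounds_of_torusFn_eq_zero {p : (EuclideanSpace ℝ (Fin 5))} (hp : torusFn p = 0) : 1 ≤ sqNorm p ∧ sqNorm p ≤ 9 := by
  have h1 := ringFn_le_sqNorm p
  have h2 := sqNorm_nonneg p
  simp only [torusFn] at hp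
  constructor <;> nlinarith

/-- **On `{torusFn = 0}`: `1 ≤ r²`** (`16 r² = (N + 3)² ≥ 16` as `N ≥ 1`). [folklore] -/
theorem one_le_ringFn_of_torusFn_eq_zero {p : (EuclideanSpace ℝ (Fin 5))} (hp : torusFn p = 0) : 1 ≤ ringFn p := by
  obtain ⟨h1, -⟩ := sqNorm_bounds_of_torusFn_eq_zero hp
  simp only [torusFn] at hp
  nlinarith

/-! ### §2 The round `S¹ × S³` as a regular level -/

/-- **`0` is a regular level of `torusFn`.**  If `dTorusFn(p) = 0` then `p₂ = p₃ = p₄ = 0` and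
(`p ≠ 0` on the level) `‖p‖² = 5 = r²`, where `torusFn = 64 - 80 ≠ 0`. [folklore] -/
theorem isRegularLevel_torusFn : IsRegularLevel (𝓡 5) torusFn 0 where
  contMDiff := contDiff_torusFn.contMDiff
  isInteriorPoint _ _ := isInteriorPoint_euclidean _
  not_isMCriticalPt := by
    intro p hp hc
    rw [isMCriticalPt_iff_fderiv, fderiv_torusFn] at hc
    have h := fun i => congrArg (fun L : ((EuclideanSpace ℝ (Fin 5))) →L[ℝ] ℝ => L (E5 i)) hc
    have h0 := h 0
    have h1 := h 1
    have h2 := h 2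
    have h3 := h 3
    have h4 := h 4
    simp only [dTorusFn_apply, E5_apply] at h0 h1 h2 h3 h4
    simp only [Fin.isValue, ↓reduceIte, Fin.reduceEq, mul_one, mul_zero, add_zero, zero_add,
      zero_apply] at h0 h1 h2 h3 h4
    have hN := sqNorm_nonneg p
    have hN3 : 4 * (sqNorm p + 3) ≠ 0 := by positivity
    have hp2 : p 2 = 0 := by
      rcases mul_eq_zero.1 h2 with h | h
      · exact absurd h hN3
      · exact h
    have hp3 : p 3 = 0 := by
      rcases mul_eq_zero.1 h3 with h | h
      · exact absurd h hN3
      · exact h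
    have hp4 : p 4 = 0 := by
      rcases mul_eq_zero.1 h4 with h | h
      · exact absurd h hN3
      · exact h
    have hp0 : torusFn p = 0 := hp
    simp only [torusFn, sqNorm, ringFn, hp2, hp3, hp4] at hp0 h0 h1
    -- `p₀, p₁` not both zero (else `torusFn = 9`), so `N = 5`; then `torusFn = -16 ≠ 0`
    rcases mul_eq_zero.1 h0 with h0' | h0'
    · nlinarith [sq_nonneg (p 0), sq_nonneg (p 1)]
    · rcases mul_eq_zero.1 h1 with h1' | h1'
      · nlinarith [sq_nonneg (p 0), sq_nonneg (p 1)]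
      · rw [h0', h1'] at hp0; norm_num at hp0

/-- **The round `S¹ × S³`** `T = {p ∈ ℝ⁵ | torusFn p = 0}`, a closed smooth `4`-manifold
(`Literature.Topology.FourManifolds.RegularLevel`, charted on `ℝ⁴`). [folklore] -/
abbrev LevelTorus : Type := RegularLevel isRegularLevel_torusFn

/-- The inclusion `T → ℝ⁵`. [folklore] -/
abbrev ιT : LevelTorus → (EuclideanSpace ℝ (Fin 5)) := RegularLevel.incl isRegularLevel_torusFn

/-- Points of `T` satisfy `torusFn = 0`. [folklore] -/
theorem torusFn_ιT (q : LevelTorus) : torusFn (ιT q) = 0 := RegularLevel.apply_incl _ q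

/-- `T` is compact: closed and contained in the ball of radius `3`. [folklore] -/
instance : CompactSpace LevelTorus := by
  refine (isCompact_iff_compactSpace (X := (EuclideanSpace ℝ (Fin 5))) (s := torusFn ⁻¹' {(0 : ℝ)})).1 ?_
  refine Metric.isCompact_of_isClosed_isBounded (isRegularLevel_torusFn.isClosed_preimage) ?_
  refine (Metric.isBounded_closedBall (x := (0 : (EuclideanSpace ℝ (Fin 5)))) (r := 3)).subset fun p hp => ?_
  have hp' : torusFn p = 0 := hp
  obtain ⟨-, h9⟩ := sqNorm_bounds_of_torusFn_eq_zero hp'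
  rw [sqNorm_eq_norm_sq] at h9
  rw [mem_closedBall, dist_zero_right]
  nlinarith [norm_nonneg p]

/-! ### §3 The height function `p₀` on `T` and its four critical points (Lagrange) -/

/-- The point `s e₀ = (s, 0, 0, 0, 0)` of the axis of symmetry `p₁ = ⋯ = p₄ = 0`. [folklore] -/
def axisPt (s : ℝ) : (EuclideanSpace ℝ (Fin 5)) := EuclideanSpace.single 0 s

/-- Coordinates of `s e₀`. [folklore] -/
@[simp] theorem axisPt_apply (s : ℝ) (i : Fin 5) : axisPt s i = if i = 0 then s else 0 := by
  simp [axisPt]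

/-- `N(s e₀) = s²`. [folklore] -/
theorem sqNorm_axisPt (s : ℝ) : sqNorm (axisPt s) = s ^ 2 := by simp [sqNorm]

/-- `r²(s e₀) = s²`. [folklore] -/
theorem ringFn_axisPt (s : ℝ) : ringFn (axisPt s) = s ^ 2 := by simp [ringFn]

/-- `torusFn(s e₀) = (s² - 1)(s² - 9)`. [folklore] -/
theorem torusFn_axisPt (s : ℝ) : torusFn (axisPt s) = (s ^ 2 - 1) * (s ^ 2 - 9) := by
  simp only [torusFn, sqNorm_axisPt, ringFn_axisPt]; ring

/-- The four critical values of the height: `s ∈ {1, -1, 3, -3}`. [folklore] -/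
def IsAxisVal (s : ℝ) : Prop := s = 1 ∨ s = -1 ∨ s = 3 ∨ s = -3

/-- The four axis points `±e₀, ±3e₀` lie on `T`. [folklore] -/
theorem IsAxisVal.torusFn_eq_zero {s : ℝ} (hs : IsAxisVal s) : torusFn (axisPt s) = 0 := by
  rw [RoundCircleProdSphereThree.torusFn_axisPt]
  rcases hs with rfl | rfl | rfl | rfl <;> norm_num

/-- `s ≠ 0` for `s ∈ {±1, ±3}`. [folklore] -/
theorem IsAxisVal.ne_zero {s : ℝ} (hs : IsAxisVal s) : s ≠ 0 := by
  rcases hs with rfl | rfl | rfl | rfl <;> norm_num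

/-- `s² ≠ 5` for `s ∈ {±1, ±3}`. [folklore] -/
theorem IsAxisVal.sq_ne_five {s : ℝ} (hs : IsAxisVal s) : s ^ 2 - 5 ≠ 0 := by
  rcases hs with rfl | rfl | rfl | rfl <;> norm_num

/-- `dTorusFn(s e₀) = 4 s (s² - 5) dp₀`. [folklore] -/
theorem dtorusFn_axisPt_apply (s : ℝ) (v : (EuclideanSpace ℝ (Fin 5))) : dTorusFn (axisPt s) v = 4 * s * (s ^ 2 - 5) * v 0 := by
  rw [dTorusFn_apply, sqNorm_axisPt]
  simp only [axisPt_apply]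
  simp only [Fin.isValue, ↓reduceIte, Fin.reduceEq]
  ring

/-- **Lagrange's condition for the height `p₀` on `T`, solved**: if `torusFn p = 0` and `dp₀`
vanishes on `ker dTorusFn(p)`, then `p = s e₀` with `s ∈ {±1, ±3}`.  (Testing
`v = dTorusFn(e₀) eᵢ - dTorusFn(eᵢ) e₀ ∈ ker dTorusFn(p)` gives `dTorusFn(p) eᵢ = 0` for `i ≥ 1`: `p₂ = p₃ = p₄ = 0`, and
`p₁ = 0` — else `‖p‖² = 5 = r²` where `torusFn = -16` —; then `(p₀² - 1)(p₀² - 9) = 0`.) [folklore] -/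
theorem eq_axisPt_of_lagrange {p : (EuclideanSpace ℝ (Fin 5))} (hG : torusFn p = 0) (h : ∀ v : (EuclideanSpace ℝ (Fin 5)), dTorusFn p v = 0 → v 0 = 0) :
    ∃ s, IsAxisVal s ∧ p = axisPt s := by
  -- `dTorusFn(p) eᵢ = 0` for `i = 1, …, 4`
  have hi : ∀ i : Fin 5, i ≠ 0 → dTorusFn p (E5 i) = 0 := by
    intro i hi0
    have hv := h ((dTorusFn p (E5 0)) • E5 i - (dTorusFn p (E5 i)) • E5 0) (by simp [mul_comm])
    simp only [PiLp.sub_apply, PiLp.smul_apply, E5_apply, smul_eq_mul, if_neg (Ne.symm hi0)] at hv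
    simpa using hv
  have h1 := hi 1 (by decide)
  have h2 := hi 2 (by decide)
  have h3 := hi 3 (by decide)
  have h4 := hi 4 (by decide)
  simp only [dTorusFn_apply, E5_apply] at h1 h2 h3 h4
  simp only [Fin.isValue, ↓reduceIte, Fin.reduceEq, mul_one, mul_zero, add_zero, zero_add] at h1 h2 h3 h4
  have hN := sqNorm_nonneg p
  have hN3 : 4 * (sqNorm p + 3) ≠ 0 := by positivity
  have hp2 : p 2 = 0 := by
    rcases mul_eq_zero.1 h2 with h | h
    · exact absurd h hN3
    · exact h
  have hp3 : p 3 = 0 := by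
    rcases mul_eq_zero.1 h3 with h | h
    · exact absurd h hN3
    · exact h
  have hp4 : p 4 = 0 := by
    rcases mul_eq_zero.1 h4 with h | h
    · exact absurd h hN3
    · exact h
  have hG' := hG
  simp only [torusFn, sqNorm, ringFn, hp2, hp3, hp4] at hG' h1
  have hp1 : p 1 = 0 := by
    rcases mul_eq_zero.1 h1 with h | h
    · exfalso; nlinarith [sq_nonneg (p 0), sq_nonneg (p 1)]
    · exact h
  rw [hp1] at hG'
  have hs : IsAxisVal (p 0) := by
    have h0 : (p 0 - 1) * (p 0 + 1) * ((p 0 - 3) * (p 0 + 3)) = 0 := by nlinarith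
    rcases mul_eq_zero.1 h0 with h0 | h0
    · rcases mul_eq_zero.1 h0 with h0 | h0
      · exact Or.inl (by linarith)
      · exact Or.inr (Or.inl (by linarith))
    · rcases mul_eq_zero.1 h0 with h0 | h0
      · exact Or.inr (Or.inr (Or.inl (by linarith)))
      · exact Or.inr (Or.inr (Or.inr (by linarith)))
  refine ⟨p 0, hs, ?_⟩
  ext i
  fin_cases i <;> simp [hp1, hp2, hp3, hp4]

/-- Conversely, at `s e₀` (`s ≠ 0`, `s² ≠ 5`) the kernel of `dTorusFn` is `{v₀ = 0}`, on which
`dp₀` vanishes. [folklore] -/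
theorem lagrange_axisPt {s : ℝ} (hs : IsAxisVal s) (v : (EuclideanSpace ℝ (Fin 5))) (hv : dTorusFn (axisPt s) v = 0) :
    v 0 = 0 := by
  rw [dtorusFn_axisPt_apply] at hv
  have h4 : 4 * s * (s ^ 2 - 5) ≠ 0 := by
    have := hs.ne_zero; have := hs.sq_ne_five; positivity
  rcases mul_eq_zero.1 hv with h | h
  · exact absurd h h4
  · exact h

/-- **The height function** `p₀` on `T`. [folklore] -/
def heightT (q : LevelTorus) : ℝ := ιT q 0

/-- The height is the restriction of `p ↦ p₀`. [folklore] -/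
theorem heightT_eq : heightT = (fun p : (EuclideanSpace ℝ (Fin 5)) => p 0) ∘ ιT := rfl

/-- `p ↦ p₀` is smooth on `ℝ⁵`. [folklore] -/
theorem contDiff_height : ContDiff ℝ ∞ (fun p : (EuclideanSpace ℝ (Fin 5)) => p 0) := (π 0).contDiff

/-- `d(p₀) = dp₀`. [folklore] -/
theorem fderiv_height (p : (EuclideanSpace ℝ (Fin 5))) : fderiv ℝ (fun p : (EuclideanSpace ℝ (Fin 5)) => p 0) p = π 0 :=
  (hasFDerivAt_coord 0 p).fderiv

/-- The height is smooth on `T`. [folklore] -/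
theorem contMDiff_heightT : ContMDiff (𝓡 4) 𝓘(ℝ, ℝ) ∞ heightT :=
  contDiff_height.contMDiff.comp (RegularLevel.contMDiff_incl _)

/-- **Critical points of a restricted ambient function on `T`, by Lagrange** (identity chart
of `ℝ⁵`). [cite: Milnor1963, §2] -/
theorem isMCriticalPt_comp_ιT_iff {F : (EuclideanSpace ℝ (Fin 5)) → ℝ} (hF : ContDiff ℝ ∞ F) (q : LevelTorus) :
    IsMCriticalPt (𝓡 4) (F ∘ ιT) q ↔
      ∀ v : (EuclideanSpace ℝ (Fin 5)), fderiv ℝ torusFn (ιT q) v = 0 → fderiv ℝ F (ιT q) v = 0 := by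
  have h := RegularLevel.isMCriticalPt_comp_incl_iff_of_chart (h := isRegularLevel_torusFn) (F := F) q
    (hF.contMDiff.of_le (by norm_cast)).contMDiffAt refl_mem_maximalAtlas (by simp)
  exact h

/-- **The critical points of the height on `T` are the four axis points `±e₀, ±3e₀`.**
[cite: Milnor1963, §2] -/
theorem isMCriticalPt_heightT_iff (q : LevelTorus) :
    IsMCriticalPt (𝓡 4) heightT q ↔ ∃ s, IsAxisVal s ∧ ιT q = axisPt s := by
  rw [heightT_eq, isMCriticalPt_comp_ιT_iff contDiff_height]
  simp only [fderiv_torusFn, fderiv_height, π_apply]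
  constructor
  · intro h
    exact eq_axisPt_of_lagrange (torusFn_ιT q) h
  · rintro ⟨s, hs, hq⟩ v hv
    rw [hq] at hv
    exact lagrange_axisPt hs v hv

/-- **The axis point `s e₀` of `T`** (`s ∈ {±1, ±3}`). [folklore] -/
def axisT (s : ℝ) (hs : IsAxisVal s) : LevelTorus := ⟨axisPt s, hs.torusFn_eq_zero⟩

/-- `ι (s e₀) = s e₀`. [folklore] -/
@[simp] theorem ιT_axisT (s : ℝ) (hs : IsAxisVal s) : ιT (axisT s hs) = axisPt s := rfl

/-- The height of `s e₀` is `s`. [folklore] -/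
theorem heightT_axisT (s : ℝ) (hs : IsAxisVal s) : heightT (axisT s hs) = s := by
  simp [heightT]

/-- A point of `T` lying at `s e₀` is `axisT s`. [folklore] -/
theorem eq_axisT_of_ιT_eq {q : LevelTorus} {s : ℝ} (hs : IsAxisVal s) (h : ιT q = axisPt s) :
    q = axisT s hs :=
  Subtype.ext h

/-- The axis points are distinct for distinct `s`. [folklore] -/
theorem axisT_injective {s t : ℝ} (hs : IsAxisVal s) (ht : IsAxisVal t)
    (h : axisT s hs = axisT t ht) : s = t := by
  have := congrArg (fun q : LevelTorus => ιT q 0) h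
  simpa using this

/-! ### §4 The ambient comparison function `p₀ - μ torusFn` and its Hessian at the axis points -/

/-- **The ambient function** `A_μ(p) = p₀ - μ torusFn(p)`: it restricts to the height on `T` for
every `μ`, and `μ` is chosen so that `A_μ` is critical on `ℝ⁵` at the axis point under study.
[folklore] -/
def ambT (μ : ℝ) (p : (EuclideanSpace ℝ (Fin 5))) : ℝ := p 0 - μ * torusFn p

/-- `A_μ` is smooth. [folklore] -/
theorem contDiff_ambT (μ : ℝ) : ContDiff ℝ ∞ (ambT μ) :=
  contDiff_height.sub (contDiff_const.mul contDiff_torusFn)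

/-- `A_μ` restricts to the height on `T` (`torusFn = 0` there), for every `μ`. [folklore] -/
theorem heightT_eq_comp (μ : ℝ) : heightT = ambT μ ∘ ιT := by
  funext q
  simp [ambT, heightT, torusFn_ιT]

/-- The two coefficient functions of `dTorusFn = a(p) (p₀ dp₀ + p₁ dp₁) + b(p) (p₂ dp₂ + p₃ dp₃ + p₄ dp₄)`:
`a = 4 ‖p‖² - 20`, `b = 4 ‖p‖² + 12`. [folklore] -/
def coefA (p : (EuclideanSpace ℝ (Fin 5))) : ℝ := 4 * sqNorm p - 20

/-- See `coefA`. [folklore] -/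
def coefB (p : (EuclideanSpace ℝ (Fin 5))) : ℝ := 4 * sqNorm p + 12

/-- `da = 4 dN`. [folklore] -/
theorem hasFDerivAt_coefA (p : (EuclideanSpace ℝ (Fin 5))) : HasFDerivAt coefA ((4 : ℝ) • dSqNorm p) p := by
  have h := ((hasFDerivAt_sqNorm p).const_mul (4 : ℝ)).sub_const 20
  exact h.congr_of_eventuallyEq (Eventually.of_forall fun q => rfl)

/-- `db = 4 dN`. [folklore] -/
theorem hasFDerivAt_coefB (p : (EuclideanSpace ℝ (Fin 5))) : HasFDerivAt coefB ((4 : ℝ) • dSqNorm p) p := by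
  have h := ((hasFDerivAt_sqNorm p).const_mul (4 : ℝ)).add_const 12
  exact h.congr_of_eventuallyEq (Eventually.of_forall fun q => rfl)

/-- The differential of `A_μ`, written out in coordinates. [folklore] -/
def dAmbT (μ : ℝ) (p : (EuclideanSpace ℝ (Fin 5))) : ((EuclideanSpace ℝ (Fin 5))) →L[ℝ] ℝ :=
  (1 - μ * (coefA p * p 0)) • π 0 + (-(μ * (coefA p * p 1))) • π 1 +
    (-(μ * (coefB p * p 2))) • π 2 + (-(μ * (coefB p * p 3))) • π 3 + (-(μ * (coefB p * p 4))) • π 4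

/-- `dA_μ(p)` evaluated. [folklore] -/
@[simp] theorem dAmbT_apply (μ : ℝ) (p v : (EuclideanSpace ℝ (Fin 5))) :
    dAmbT μ p v = (1 - μ * (coefA p * p 0)) * v 0 + -(μ * (coefA p * p 1)) * v 1 +
      -(μ * (coefB p * p 2)) * v 2 + -(μ * (coefB p * p 3)) * v 3 + -(μ * (coefB p * p 4)) * v 4 := by
  simp [dAmbT, smul_eq_mul]

/-- `dA_μ = dp₀ - μ dTorusFn`. [folklore] -/
theorem dAmbT_eq (μ : ℝ) (p : (EuclideanSpace ℝ (Fin 5))) : dAmbT μ p = π 0 - μ • dTorusFn p := by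
  ext v
  simp only [dAmbT_apply, sub_apply, smul_apply, smul_eq_mul, π_apply, dTorusFn_apply, coefA, coefB]
  ring

/-- `A_μ` is differentiable with differential `dAmbT`. [folklore] -/
theorem hasFDerivAt_ambT (μ : ℝ) (p : (EuclideanSpace ℝ (Fin 5))) : HasFDerivAt (ambT μ) (dAmbT μ p) p := by
  have h := (hasFDerivAt_coord 0 p).sub ((hasFDerivAt_torusFn p).const_mul μ)
  have h' : HasFDerivAt (ambT μ) _ p := h.congr_of_eventuallyEq (Eventually.of_forall fun q => rfl)
  refine h'.congr_fderiv ?_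
  rw [dAmbT_eq]

/-- `fderiv A_μ = dAmbT μ`. [folklore] -/
theorem fderiv_ambT (μ : ℝ) : fderiv ℝ (ambT μ) = dAmbT μ :=
  funext fun p => (hasFDerivAt_ambT μ p).fderiv

/-- The differentials of the five coefficients of `dA_μ`. [folklore] -/
def dC0 (μ : ℝ) (p : (EuclideanSpace ℝ (Fin 5))) : ((EuclideanSpace ℝ (Fin 5))) →L[ℝ] ℝ := -(μ • (p 0 • ((4 : ℝ) • dSqNorm p) + coefA p • π 0))
/-- See `dC0`. [folklore] -/
def dC1 (μ : ℝ) (p : (EuclideanSpace ℝ (Fin 5))) : ((EuclideanSpace ℝ (Fin 5))) →L[ℝ] ℝ := -(μ • (p 1 • ((4 : ℝ) • dSqNorm p) + coefA p • π 1))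
/-- See `dC0`. [folklore] -/
def dCk (μ : ℝ) (p : (EuclideanSpace ℝ (Fin 5))) (k : Fin 5) : ((EuclideanSpace ℝ (Fin 5))) →L[ℝ] ℝ :=
  -(μ • (p k • ((4 : ℝ) • dSqNorm p) + coefB p • π k))

/-- The second differential of `A_μ` at `p`. [folklore] -/
def d2AmbT (μ : ℝ) (p : (EuclideanSpace ℝ (Fin 5))) : ((EuclideanSpace ℝ (Fin 5))) →L[ℝ] ((EuclideanSpace ℝ (Fin 5))) →L[ℝ] ℝ :=
  (dC0 μ p).smulRight (π 0) + (dC1 μ p).smulRight (π 1) + (dCk μ p 2).smulRight (π 2) +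
    (dCk μ p 3).smulRight (π 3) + (dCk μ p 4).smulRight (π 4)

/-- `dA_μ` is differentiable with differential `d2AmbT` (the second derivative). [folklore] -/
theorem hasFDerivAt_dAmbT (μ : ℝ) (p : (EuclideanSpace ℝ (Fin 5))) : HasFDerivAt (dAmbT μ) (d2AmbT μ p) p := by
  have hA := hasFDerivAt_coefA p
  have hB := hasFDerivAt_coefB p
  have h0 : HasFDerivAt (fun q : (EuclideanSpace ℝ (Fin 5)) => 1 - μ * (coefA q * q 0)) (dC0 μ p) p := by
    have := ((hA.mul (hasFDerivAt_coord 0 p)).const_mul μ).const_sub 1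
    refine (this.congr_of_eventuallyEq (Eventually.of_forall fun q => rfl)).congr_fderiv ?_
    ext v; simp [dC0, smul_eq_mul]; ring
  have h1 : HasFDerivAt (fun q : (EuclideanSpace ℝ (Fin 5)) => -(μ * (coefA q * q 1))) (dC1 μ p) p := by
    have := ((hA.mul (hasFDerivAt_coord 1 p)).const_mul μ).neg
    refine (this.congr_of_eventuallyEq (Eventually.of_forall fun q => rfl)).congr_fderiv ?_
    ext v; simp [dC1, smul_eq_mul]; ring
  have hk : ∀ k : Fin 5, HasFDerivAt (fun q : (EuclideanSpace ℝ (Fin 5)) => -(μ * (coefB q * q k))) (dCk μ p k) p := by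
    intro k
    have := ((hB.mul (hasFDerivAt_coord k p)).const_mul μ).neg
    refine (this.congr_of_eventuallyEq (Eventually.of_forall fun q => rfl)).congr_fderiv ?_
    ext v; simp [dCk, smul_eq_mul]; ring
  have h := ((((h0.smul_const (π 0)).add (h1.smul_const (π 1))).add ((hk 2).smul_const (π 2))).add
    ((hk 3).smul_const (π 3))).add ((hk 4).smul_const (π 4))
  exact h.congr_of_eventuallyEq (Eventually.of_forall fun q => rfl)

/-- The second Fréchet derivative of `A_μ` is `d2AmbT μ`. [folklore] -/
theorem fderiv_fderiv_ambT (μ : ℝ) (p : (EuclideanSpace ℝ (Fin 5))) : fderiv ℝ (fderiv ℝ (ambT μ)) p = d2AmbT μ p := by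
  rw [fderiv_ambT]
  exact (hasFDerivAt_dAmbT μ p).fderiv

/-- **The Lagrange multiplier** at `s e₀`: `μ(s) = 1 / (4 s (s² - 5))`. [folklore] -/
def multT (s : ℝ) : ℝ := 1 / (4 * s * (s ^ 2 - 5))

/-- `a(s e₀) = 4s² - 20`. [folklore] -/
theorem coefA_axisPt (s : ℝ) : coefA (axisPt s) = 4 * s ^ 2 - 20 := by
  simp [coefA, sqNorm_axisPt]

/-- `b(s e₀) = 4s² + 12`. [folklore] -/
theorem coefB_axisPt (s : ℝ) : coefB (axisPt s) = 4 * s ^ 2 + 12 := by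
  simp [coefB, sqNorm_axisPt]

/-- **`A_{μ(s)}` is critical on `ℝ⁵` at `s e₀`** (`s ∈ {±1, ±3}`). [folklore] -/
theorem dAmbT_axisPt {s : ℝ} (hs : IsAxisVal s) : dAmbT (multT s) (axisPt s) = 0 := by
  have h0 := hs.ne_zero
  have h5 := hs.sq_ne_five
  ext v
  rw [dAmbT_apply, zero_apply, coefA_axisPt, coefB_axisPt]
  simp only [axisPt_apply, multT]
  simp only [Fin.isValue, Fin.reduceEq, ↓reduceIte, mul_zero, neg_zero, zero_mul, add_zero]
  have : 1 - 1 / (4 * s * (s ^ 2 - 5)) * ((4 * s ^ 2 - 20) * s) = 0 := by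
    field_simp
    ring
  rw [this, zero_mul]

/-- **The Hessian of `A_{μ(s)}` at `s e₀`**: with `μ = μ(s)`,
`-μ [(12 s² - 20) v₀w₀ + (4 s² - 20) v₁w₁ + (4 s² + 12)(v₂w₂ + v₃w₃ + v₄w₄)]`. [folklore] -/
theorem d2AmbT_axisPt (s : ℝ) (v w : (EuclideanSpace ℝ (Fin 5))) :
    d2AmbT (multT s) (axisPt s) v w =
      (-(multT s * (12 * s ^ 2 - 20))) * (v 0 * w 0) + (-(multT s * (4 * s ^ 2 - 20))) * (v 1 * w 1) +
        (-(multT s * (4 * s ^ 2 + 12))) * (v 2 * w 2 + v 3 * w 3 + v 4 * w 4) := by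
  simp only [d2AmbT, dC0, dC1, dCk, coefA_axisPt, coefB_axisPt, add_apply,
    ContinuousLinearMap.smulRight_apply, neg_apply, smul_apply, smul_eq_mul, π_apply, dSqNorm_apply,
    axisPt_apply]
  simp only [Fin.isValue, ↓reduceIte, Fin.reduceEq]
  ring

/-! ### §5 Hessians at the axis points: the restricted ambient Hessian, and Sylvester on `{v₀ = 0}` -/

/-- The tangent hyperplane `ker dTorusFn(x)` of `T`, read in `ℝ⁵`. [folklore] -/
def tangentKerT (x : (EuclideanSpace ℝ (Fin 5))) : Submodule ℝ ((EuclideanSpace ℝ (Fin 5))) :=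
  LinearMap.ker ((fderiv ℝ torusFn x : ((EuclideanSpace ℝ (Fin 5))) →L[ℝ] ℝ) : ((EuclideanSpace ℝ (Fin 5))) →ₗ[ℝ] ℝ)

/-- `ker dTorusFn(s e₀) = {v | v₀ = 0}` (`s ∈ {±1, ±3}`). [folklore] -/
theorem mem_tangentKerT_axisPt_iff {s : ℝ} (hs : IsAxisVal s) (v : (EuclideanSpace ℝ (Fin 5))) :
    v ∈ tangentKerT (axisPt s) ↔ v 0 = 0 := by
  rw [tangentKerT, LinearMap.mem_ker, fderiv_torusFn]
  change dTorusFn (axisPt s) v = 0 ↔ v 0 = 0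
  rw [dtorusFn_axisPt_apply]
  have h4 : 4 * s * (s ^ 2 - 5) ≠ 0 := by
    have := hs.ne_zero; have := hs.sq_ne_five; positivity
  constructor
  · intro h
    rcases mul_eq_zero.1 h with h | h
    · exact absurd h h4
    · exact h
  · intro h; rw [h, mul_zero]

/-- The Hessian of `A_μ` at `x` in the identity chart of `ℝ⁵`. [cite: Milnor1963, §2] -/
def ambHessT (μ : ℝ) (x : (EuclideanSpace ℝ (Fin 5))) : LinearMap.BilinForm ℝ ((EuclideanSpace ℝ (Fin 5))) :=
  hessianInChart (𝓡 5) (OpenPartialHomeomorph.refl ((EuclideanSpace ℝ (Fin 5)))) (ambT μ) x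

/-- `ambHessT μ x = d²A_μ(x)`. [folklore] -/
theorem ambHessT_apply (μ : ℝ) (x v w : (EuclideanSpace ℝ (Fin 5))) : ambHessT μ x v w = d2AmbT μ x v w := by
  rw [ambHessT, RegularLevel.hessianInChart_apply_eq]
  change fderiv ℝ (fderiv ℝ (ambT μ)) x v w = _
  rw [fderiv_fderiv_ambT]

/-- `A_{μ(s)}` is critical on `ℝ⁵` at `s e₀`. [folklore] -/
theorem isMCriticalPt_ambT_axisPt {s : ℝ} (hs : IsAxisVal s) :
    IsMCriticalPt (𝓡 5) (ambT (multT s)) (axisPt s) := by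
  rw [isMCriticalPt_iff_fderiv, fderiv_ambT]
  exact dAmbT_axisPt hs

/-- **Nondegeneracy of `Hess(p₀|T)` at `s e₀` is that of the restricted ambient Hessian**
(`RegularLevel.nondegenerate_mhessian_comp_incl_iff` in the identity chart). [cite: Milnor1963, §2] -/
theorem nondegenerate_mhessian_heightT_iff {s : ℝ} (hs : IsAxisVal s) :
    (mhessian (𝓡 4) heightT (axisT s hs)).Nondegenerate ↔
      ((ambHessT (multT s) (axisPt s)).restrict (tangentKerT (axisPt s))).Nondegenerate := by
  rw [heightT_eq_comp (multT s)]
  exact RegularLevel.nondegenerate_mhessian_comp_incl_iff (h := isRegularLevel_torusFn) (axisT s hs)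
    (((contDiff_ambT _).contMDiff.of_le (by norm_cast)).contMDiffAt) (isMCriticalPt_ambT_axisPt hs)
    refl_mem_maximalAtlas (by simp)

/-- **The Morse index of `p₀|T` at `s e₀` is the negative index of inertia of the restricted
ambient Hessian** (`RegularLevel.morseIndex_comp_incl_eq`). [cite: Milnor1963, §2] -/
theorem morseIndex_heightT_eq {s : ℝ} (hs : IsAxisVal s) :
    morseIndex (𝓡 4) heightT (axisT s hs) =
      sigNeg ((ambHessT (multT s) (axisPt s)).restrict (tangentKerT (axisPt s))).toQuadraticMap := by
  rw [heightT_eq_comp (multT s)]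
  exact RegularLevel.morseIndex_comp_incl_eq (h := isRegularLevel_torusFn) (axisT s hs)
    (((contDiff_ambT _).contMDiff.of_le (by norm_cast)).contMDiffAt) (isMCriticalPt_ambT_axisPt hs)
    refl_mem_maximalAtlas (by simp)

section Sylvester

variable {V : Submodule ℝ ((EuclideanSpace ℝ (Fin 5)))} {B : LinearMap.BilinForm ℝ ((EuclideanSpace ℝ (Fin 5)))} {a b c : ℝ}

/-- The hyperplane `{v₀ = 0}` of `ℝ⁵` has dimension `4` (kernel of the nonzero functional
`dp₀`). [folklore] -/
theorem finrank_eq_four_of_mem_iff (hV : ∀ v, v ∈ V ↔ v 0 = 0) : finrank ℝ V = 4 := by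
  have hVk : V = LinearMap.ker ((π 0 : ((EuclideanSpace ℝ (Fin 5))) →L[ℝ] ℝ) : ((EuclideanSpace ℝ (Fin 5))) →ₗ[ℝ] ℝ) := by
    ext v; rw [hV, LinearMap.mem_ker]; rfl
  have hsurj : LinearMap.range ((π 0 : ((EuclideanSpace ℝ (Fin 5))) →L[ℝ] ℝ) : ((EuclideanSpace ℝ (Fin 5))) →ₗ[ℝ] ℝ) = ⊤ := by
    rw [LinearMap.range_eq_top]
    intro t
    refine ⟨t • E5 0, ?_⟩
    simp
  have h := LinearMap.finrank_range_add_finrank_ker ((π 0 : ((EuclideanSpace ℝ (Fin 5))) →L[ℝ] ℝ) : ((EuclideanSpace ℝ (Fin 5))) →ₗ[ℝ] ℝ)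
  rw [hsurj, finrank_top, Module.finrank_self, finrank_euclideanSpace_fin] at h
  rw [hVk]
  omega

/-- **Sylvester on the hyperplane `{v₀ = 0}`**: a form
`c v₀w₀ + a v₁w₁ + b (v₂w₂ + v₃w₃ + v₄w₄)` with `a, b ≠ 0` restricts to a nondegenerate form on
`V = {v₀ = 0}` whose negative index of inertia counts the negative coefficients among
`a, b, b, b` (the `B`-orthogonal family `e₁, …, e₄` of full size, the tree's
`LinearMap.BilinForm.sigPos_eq_card_of_orthogonal`; Milnor 1963, §2; Serre, Ch. IV §2.4).
[cite: Milnor1963, §2] [cite: Serre1973, Ch. IV §2.4] -/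
theorem nondegenerate_and_sigNeg_restrict_of_apply_eq (ha : a ≠ 0) (hb : b ≠ 0)
    (hB : ∀ v w, B v w = c * (v 0 * w 0) + a * (v 1 * w 1) + b * (v 2 * w 2 + v 3 * w 3 + v 4 * w 4))
    (hV : ∀ v, v ∈ V ↔ v 0 = 0) :
    (B.restrict V).Nondegenerate ∧
      sigNeg (B.restrict V).toQuadraticMap = (if a < 0 then 1 else 0) + (if b < 0 then 3 else 0) := by
  have hE1 : E5 1 ∈ V := (hV _).2 (by simp)
  have hE2 : E5 2 ∈ V := (hV _).2 (by simp)
  have hE3 : E5 3 ∈ V := (hV _).2 (by simp)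
  have hE4 : E5 4 ∈ V := (hV _).2 (by simp)
  -- the values of `B` on the basis vectors `e₁, …, e₄`
  have d1 : B (E5 1) (E5 1) = a := by rw [hB]; simp
  have d2 : B (E5 2) (E5 2) = b := by rw [hB]; simp
  have d3 : B (E5 3) (E5 3) = b := by rw [hB]; simp
  have d4 : B (E5 4) (E5 4) = b := by rw [hB]; simp
  have o12 : B (E5 1) (E5 2) = 0 := by rw [hB]; simp
  have o13 : B (E5 1) (E5 3) = 0 := by rw [hB]; simp
  have o14 : B (E5 1) (E5 4) = 0 := by rw [hB]; simp
  have o21 : B (E5 2) (E5 1) = 0 := by rw [hB]; simp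
  have o23 : B (E5 2) (E5 3) = 0 := by rw [hB]; simp
  have o24 : B (E5 2) (E5 4) = 0 := by rw [hB]; simp
  have o31 : B (E5 3) (E5 1) = 0 := by rw [hB]; simp
  have o32 : B (E5 3) (E5 2) = 0 := by rw [hB]; simp
  have o34 : B (E5 3) (E5 4) = 0 := by rw [hB]; simp
  have o41 : B (E5 4) (E5 1) = 0 := by rw [hB]; simp
  have o42 : B (E5 4) (E5 2) = 0 := by rw [hB]; simp
  have o43 : B (E5 4) (E5 3) = 0 := by rw [hB]; simp
  -- nondegeneracy: test against `e₁, …, e₄ ∈ V`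
  have hsep : ∀ x : V, (∀ y : V, B x y = 0) → x = 0 := by
    intro x hx
    have hx0 : (x : (EuclideanSpace ℝ (Fin 5))) 0 = 0 := (hV _).1 x.2
    have h1 := hx ⟨E5 1, hE1⟩
    have h2 := hx ⟨E5 2, hE2⟩
    have h3 := hx ⟨E5 3, hE3⟩
    have h4 := hx ⟨E5 4, hE4⟩
    simp only [hB, E5_apply] at h1 h2 h3 h4
    simp only [Fin.isValue, ↓reduceIte, mul_one, Fin.reduceEq, mul_zero, add_zero, zero_add,
      mul_eq_zero, ha, hb, false_or] at h1 h2 h3 h4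
    refine Subtype.ext ?_
    ext i
    fin_cases i
    · simpa using hx0
    · simpa using h1
    · simpa using h2
    · simpa using h3
    · simpa using h4
  have hsymm : ∀ x y : V, B x y = B y x := fun x y => by
    rw [hB, hB]; ring
  refine ⟨⟨fun x hx => hsep x (fun y => by simpa using hx y),
    fun x hx => hsep x (fun y => by rw [hsymm]; simpa using hx y)⟩, ?_⟩
  -- the index: the orthogonal family `e₁, …, e₄`
  let f : Fin 4 → V := ![⟨E5 1, hE1⟩, ⟨E5 2, hE2⟩, ⟨E5 3, hE3⟩, ⟨E5 4, hE4⟩]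
  have hf : ∀ i, (B.restrict V) (f i) (f i) = ![a, b, b, b] i := by
    intro i
    fin_cases i <;>
      simp [f, LinearMap.BilinForm.restrict_apply, LinearMap.domRestrict_apply, d1, d2, d3, d4]
  have horth : Pairwise fun i j => (B.restrict V) (f i) (f j) = 0 := by
    intro i j hij
    fin_cases i <;> fin_cases j <;> first | exact absurd rfl hij |
      simp [f, LinearMap.BilinForm.restrict_apply, LinearMap.domRestrict_apply, o12, o13, o14, o21,
        o23, o24, o31, o32, o34, o41, o42, o43]
  have h0 : ∀ i, (B.restrict V) (f i) (f i) ≠ 0 := by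
    intro i; rw [hf]; fin_cases i <;> simpa
  have hcard : Fintype.card (Fin 4) = finrank ℝ V := by
    rw [Fintype.card_fin, finrank_eq_four_of_mem_iff hV]
  obtain ⟨-, hneg⟩ := LinearMap.BilinForm.sigPos_eq_card_of_orthogonal (B.restrict V) f horth h0 hcard
  rw [hneg, Fintype.card_subtype, Finset.card_filter, Fin.sum_univ_four]
  simp only [hf]
  simp only [Matrix.cons_val_zero, Matrix.cons_val_one, Matrix.cons_val]
  by_cases ha' : a < 0 <;> by_cases hb' : b < 0 <;> simp [ha', hb']

end Sylvester

/-- **At `s e₀` the restricted Hessian is nondegenerate, of index `#{a < 0} + 3·[b < 0]`** with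
`a = -μ(s)(4s² - 20) = -1/s`, `b = -μ(s)(4s² + 12)`: index `0, 1, 3, 4` at `s = -3, 1, -1, 3`.
[cite: Milnor1963, §2] -/
theorem nondegenerate_and_sigNeg_axisPt {s : ℝ} (hs : IsAxisVal s) :
    ((ambHessT (multT s) (axisPt s)).restrict (tangentKerT (axisPt s))).Nondegenerate ∧
      sigNeg ((ambHessT (multT s) (axisPt s)).restrict (tangentKerT (axisPt s))).toQuadraticMap =
        (if -(multT s * (4 * s ^ 2 - 20)) < 0 then 1 else 0) +
          (if -(multT s * (4 * s ^ 2 + 12)) < 0 then 3 else 0) := by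
  have h0 := hs.ne_zero
  have h5 := hs.sq_ne_five
  refine nondegenerate_and_sigNeg_restrict_of_apply_eq (c := -(multT s * (12 * s ^ 2 - 20))) ?_ ?_
    (fun v w => by rw [ambHessT_apply, d2AmbT_axisPt]) (mem_tangentKerT_axisPt_iff hs)
  · have h4 : 4 * s * (s ^ 2 - 5) ≠ 0 := by positivity
    have : 4 * s ^ 2 - 20 = 4 * (s ^ 2 - 5) := by ring
    rw [this, multT, neg_ne_zero]
    exact mul_ne_zero (one_div_ne_zero h4) (mul_ne_zero four_ne_zero h5)
  · have h4 : 4 * s * (s ^ 2 - 5) ≠ 0 := by positivity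
    have h12 : 4 * s ^ 2 + 12 ≠ 0 := by positivity
    rw [multT, neg_ne_zero]
    exact mul_ne_zero (one_div_ne_zero h4) h12

/-! ### §6 The height is a Morse function on `T` with critical points of index `0, 1, 3, 4` -/

/-- **The height `p₀|T` is a Morse function.** [cite: Milnor1963, §2] -/
theorem isMorse_heightT : IsMorse (𝓡 4) heightT := by
  refine ⟨contMDiff_heightT, fun q hq => ?_⟩
  obtain ⟨s, hs, hqs⟩ := (isMCriticalPt_heightT_iff q).1 hq
  rw [eq_axisT_of_ιT_eq hs hqs]
  exact (nondegenerate_mhessian_heightT_iff hs).2 (nondegenerate_and_sigNeg_axisPt hs).1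

/-- The Morse index of the height at `s e₀`, as the explicit count. [cite: Milnor1963, §2] -/
theorem morseIndex_heightT_axisT {s : ℝ} (hs : IsAxisVal s) :
    morseIndex (𝓡 4) heightT (axisT s hs) =
      (if -(multT s * (4 * s ^ 2 - 20)) < 0 then 1 else 0) +
        (if -(multT s * (4 * s ^ 2 + 12)) < 0 then 3 else 0) := by
  rw [morseIndex_heightT_eq hs]
  exact (nondegenerate_and_sigNeg_axisPt hs).2

/-- `1 ∈ {±1, ±3}`. [folklore] -/
theorem isAxisVal_one : IsAxisVal 1 := Or.inl rfl
/-- `-1 ∈ {±1, ±3}`. [folklore] -/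
theorem isAxisVal_neg_one : IsAxisVal (-1) := Or.inr (Or.inl rfl)
/-- `3 ∈ {±1, ±3}`. [folklore] -/
theorem isAxisVal_three : IsAxisVal 3 := Or.inr (Or.inr (Or.inl rfl))
/-- `-3 ∈ {±1, ±3}`. [folklore] -/
theorem isAxisVal_neg_three : IsAxisVal (-3) := Or.inr (Or.inr (Or.inr rfl))

/-- **Index `0` at `-3e₀`** (the minimum of the height). [cite: Milnor1963, §2] -/
theorem morseIndex_heightT_neg_three : morseIndex (𝓡 4) heightT (axisT (-3) isAxisVal_neg_three) = 0 := by
  rw [morseIndex_heightT_axisT]; norm_num [multT]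

/-- **Index `1` at `e₀`.** [cite: Milnor1963, §2] -/
theorem morseIndex_heightT_one : morseIndex (𝓡 4) heightT (axisT 1 isAxisVal_one) = 1 := by
  rw [morseIndex_heightT_axisT]; norm_num [multT]

/-- **Index `3` at `-e₀`.** [cite: Milnor1963, §2] -/
theorem morseIndex_heightT_neg_one : morseIndex (𝓡 4) heightT (axisT (-1) isAxisVal_neg_one) = 3 := by
  rw [morseIndex_heightT_axisT]; norm_num [multT]

/-- **Index `4` at `3e₀`** (the maximum of the height). [cite: Milnor1963, §2] -/
theorem morseIndex_heightT_three : morseIndex (𝓡 4) heightT (axisT 3 isAxisVal_three) = 4 := by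
  rw [morseIndex_heightT_axisT]; norm_num [multT]

/-- The index of the height at the axis point `s e₀`, by cases on `s`. [cite: Milnor1963, §2] -/
theorem morseIndex_heightT_axisT_eq {s : ℝ} (hs : IsAxisVal s) :
    morseIndex (𝓡 4) heightT (axisT s hs) =
      if s = -3 then 0 else if s = 1 then 1 else if s = -1 then 3 else 4 := by
  rcases hs with rfl | rfl | rfl | rfl
  · rw [morseIndex_heightT_one]; norm_num
  · rw [morseIndex_heightT_neg_one]; norm_num
  · rw [morseIndex_heightT_three]; norm_num
  · rw [morseIndex_heightT_neg_three]; norm_num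

/-- **The critical points of the height of index `k`**: `{-3e₀}`, `{e₀}`, `∅`, `{-e₀}`, `{3e₀}`
for `k = 0, 1, 2, 3, 4`. [cite: Milnor1963, §2] -/
theorem criticalSetOfIndex_heightT (k : ℕ) :
    criticalSetOfIndex (𝓡 4) heightT k =
      if k = 0 then {axisT (-3) isAxisVal_neg_three} else if k = 1 then {axisT 1 isAxisVal_one}
        else if k = 3 then {axisT (-1) isAxisVal_neg_one}
        else if k = 4 then {axisT 3 isAxisVal_three} else ∅ := by
  ext q
  simp only [mem_criticalSetOfIndex]
  constructor
  · rintro ⟨hc, hi⟩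
    obtain ⟨s, hs, hqs⟩ := (isMCriticalPt_heightT_iff q).1 hc
    obtain rfl := eq_axisT_of_ιT_eq hs hqs
    rw [morseIndex_heightT_axisT_eq hs] at hi
    rcases hs with rfl | rfl | rfl | rfl <;> norm_num at hi <;> subst hi <;> simp
  · intro hq
    split_ifs at hq with h0 h1 h3 h4
    · rw [mem_singleton_iff] at hq; subst hq; subst h0
      exact ⟨(isMCriticalPt_heightT_iff _).2 ⟨_, isAxisVal_neg_three, rfl⟩, morseIndex_heightT_neg_three⟩
    · rw [mem_singleton_iff] at hq; subst hq; subst h1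
      exact ⟨(isMCriticalPt_heightT_iff _).2 ⟨_, isAxisVal_one, rfl⟩, morseIndex_heightT_one⟩
    · rw [mem_singleton_iff] at hq; subst hq; subst h3
      exact ⟨(isMCriticalPt_heightT_iff _).2 ⟨_, isAxisVal_neg_one, rfl⟩, morseIndex_heightT_neg_one⟩
    · rw [mem_singleton_iff] at hq; subst hq; subst h4
      exact ⟨(isMCriticalPt_heightT_iff _).2 ⟨_, isAxisVal_three, rfl⟩, morseIndex_heightT_three⟩
    · exact absurd hq (notMem_empty _)

/-- **The handle count of the height on `T`: `(1, 1, 0, 1, 1)`.** [cite: Milnor1963, §2] -/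
theorem ncard_criticalSetOfIndex_heightT :
    (criticalSetOfIndex (𝓡 4) heightT 0).ncard = 1 ∧ (criticalSetOfIndex (𝓡 4) heightT 1).ncard = 1 ∧
      (criticalSetOfIndex (𝓡 4) heightT 2).ncard = 0 ∧ (criticalSetOfIndex (𝓡 4) heightT 3).ncard = 1 ∧
      (criticalSetOfIndex (𝓡 4) heightT 4).ncard = 1 := by
  refine ⟨?_, ?_, ?_, ?_, ?_⟩ <;> rw [criticalSetOfIndex_heightT] <;> norm_num

/-! ### §7 `T ≅ S¹ × S³`: the explicit diffeomorphism onto Mathlib's `𝕊¹ × 𝕊³` -/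

/-- Build a vector of `ℝ⁵` from its coordinates. [folklore] -/
def tup5 (a₀ a₁ a₂ a₃ a₄ : ℝ) : (EuclideanSpace ℝ (Fin 5)) := (EuclideanSpace.equiv (Fin 5) ℝ).symm ![a₀, a₁, a₂, a₃, a₄]

/-- Coordinate `0` of `tup5`. [folklore] -/
@[simp] theorem tup5_apply_zero (a₀ a₁ a₂ a₃ a₄ : ℝ) : tup5 a₀ a₁ a₂ a₃ a₄ 0 = a₀ := by simp [tup5]
/-- Coordinate `1` of `tup5`. [folklore] -/
@[simp] theorem tup5_apply_one (a₀ a₁ a₂ a₃ a₄ : ℝ) : tup5 a₀ a₁ a₂ a₃ a₄ 1 = a₁ := by simp [tup5]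
/-- Coordinate `2` of `tup5`. [folklore] -/
@[simp] theorem tup5_apply_two (a₀ a₁ a₂ a₃ a₄ : ℝ) : tup5 a₀ a₁ a₂ a₃ a₄ 2 = a₂ := by simp [tup5]
/-- Coordinate `3` of `tup5`. [folklore] -/
@[simp] theorem tup5_apply_three (a₀ a₁ a₂ a₃ a₄ : ℝ) : tup5 a₀ a₁ a₂ a₃ a₄ 3 = a₃ := by simp [tup5]
/-- Coordinate `4` of `tup5`. [folklore] -/
@[simp] theorem tup5_apply_four (a₀ a₁ a₂ a₃ a₄ : ℝ) : tup5 a₀ a₁ a₂ a₃ a₄ 4 = a₄ := by simp [tup5]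

/-- Build a vector of `ℝ²` from its coordinates. [folklore] -/
def tup2 (a₀ a₁ : ℝ) : (EuclideanSpace ℝ (Fin 2)) := (EuclideanSpace.equiv (Fin 2) ℝ).symm ![a₀, a₁]

/-- Coordinate `0` of `tup2`. [folklore] -/
@[simp] theorem tup2_apply_zero (a₀ a₁ : ℝ) : tup2 a₀ a₁ 0 = a₀ := by simp [tup2]
/-- Coordinate `1` of `tup2`. [folklore] -/
@[simp] theorem tup2_apply_one (a₀ a₁ : ℝ) : tup2 a₀ a₁ 1 = a₁ := by simp [tup2]

/-- Build a vector of `ℝ⁴` from its coordinates. [folklore] -/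
def tup4 (a₀ a₁ a₂ a₃ : ℝ) : (EuclideanSpace ℝ (Fin 4)) := (EuclideanSpace.equiv (Fin 4) ℝ).symm ![a₀, a₁, a₂, a₃]

/-- Coordinate `0` of `tup4`. [folklore] -/
@[simp] theorem tup4_apply_zero (a₀ a₁ a₂ a₃ : ℝ) : tup4 a₀ a₁ a₂ a₃ 0 = a₀ := by simp [tup4]
/-- Coordinate `1` of `tup4`. [folklore] -/
@[simp] theorem tup4_apply_one (a₀ a₁ a₂ a₃ : ℝ) : tup4 a₀ a₁ a₂ a₃ 1 = a₁ := by simp [tup4]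
/-- Coordinate `2` of `tup4`. [folklore] -/
@[simp] theorem tup4_apply_two (a₀ a₁ a₂ a₃ : ℝ) : tup4 a₀ a₁ a₂ a₃ 2 = a₂ := by simp [tup4]
/-- Coordinate `3` of `tup4`. [folklore] -/
@[simp] theorem tup4_apply_three (a₀ a₁ a₂ a₃ : ℝ) : tup4 a₀ a₁ a₂ a₃ 3 = a₃ := by simp [tup4]

/-- A map into `ℝᵏ` (as `EuclideanSpace`) is smooth iff its coordinates are. [folklore] -/
theorem contMDiff_euclidean_iff {EM HM : Type*} [NormedAddCommGroup EM] [NormedSpace ℝ EM]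
    [TopologicalSpace HM] {IM : ModelWithCorners ℝ EM HM} {M : Type*} [TopologicalSpace M]
    [ChartedSpace HM M] {k : ℕ} {φ : M → (EuclideanSpace ℝ (Fin k))} :
    ContMDiff IM 𝓘(ℝ, (EuclideanSpace ℝ (Fin k))) ∞ φ ↔ ∀ i, ContMDiff IM 𝓘(ℝ, ℝ) ∞ fun x => φ x i := by
  constructor
  · intro h i
    exact ((EuclideanSpace.proj i : (EuclideanSpace ℝ (Fin k)) →L[ℝ] ℝ).contDiff.contMDiff).comp h
  · intro h
    have h1 : ContMDiff IM 𝓘(ℝ, Fin k → ℝ) ∞ (fun x => (EuclideanSpace.equiv (Fin k) ℝ) (φ x)) :=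
      contMDiff_pi_space.2 fun i => h i
    have h2 := ((EuclideanSpace.equiv (Fin k) ℝ).symm.contDiff.contMDiff).comp h1
    exact h2.congr fun x => by simp

/-- The norm-square identity on `𝕊¹ ⊆ ℝ²`: `c₀² + c₁² = 1`. [folklore] -/
theorem sq_add_sq_of_mem_sphereOne (c : (Metric.sphere (0 : EuclideanSpace ℝ (Fin (1 + 1))) 1)) : (c : (EuclideanSpace ℝ (Fin 2))) 0 ^ 2 + (c : (EuclideanSpace ℝ (Fin 2))) 1 ^ 2 = 1 := by
  have h : ‖(c : (EuclideanSpace ℝ (Fin 2)))‖ = 1 := mem_sphere_zero_iff_norm.1 c.2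
  rw [EuclideanSpace.norm_eq, Real.sqrt_eq_one, Fin.sum_univ_two] at h
  simp only [Real.norm_eq_abs, sq_abs] at h
  exact h

/-- The norm-square identity on `𝕊³ ⊆ ℝ⁴`. [folklore] -/
theorem sum_sq_of_mem_sphereThree (u : (Metric.sphere (0 : EuclideanSpace ℝ (Fin (3 + 1))) 1)) :
    (u : (EuclideanSpace ℝ (Fin 4))) 0 ^ 2 + (u : (EuclideanSpace ℝ (Fin 4))) 1 ^ 2 + (u : (EuclideanSpace ℝ (Fin 4))) 2 ^ 2 + (u : (EuclideanSpace ℝ (Fin 4))) 3 ^ 2 = 1 := by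
  have h : ‖(u : (EuclideanSpace ℝ (Fin 4)))‖ = 1 := mem_sphere_zero_iff_norm.1 u.2
  rw [EuclideanSpace.norm_eq, Real.sqrt_eq_one, Fin.sum_univ_four] at h
  simp only [Real.norm_eq_abs, sq_abs] at h
  exact h

/-- On `𝕊³`: `u₀ ≥ -1`. [folklore] -/
theorem neg_one_le_of_mem_sphereThree (u : (Metric.sphere (0 : EuclideanSpace ℝ (Fin (3 + 1))) 1)) : -1 ≤ (u : (EuclideanSpace ℝ (Fin 4))) 0 := by
  have h := sum_sq_of_mem_sphereThree u
  nlinarith [sq_nonneg ((u : (EuclideanSpace ℝ (Fin 4))) 1), sq_nonneg ((u : (EuclideanSpace ℝ (Fin 4))) 2), sq_nonneg ((u : (EuclideanSpace ℝ (Fin 4))) 3),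
    sq_nonneg ((u : (EuclideanSpace ℝ (Fin 4))) 0 + 1)]

/-- **The embedding** `Ψ(c, u) = ((2 + u₀) c₀, (2 + u₀) c₁, u₁, u₂, u₃)` of `𝕊¹ × 𝕊³` onto `T`.
[folklore] -/
def embFn (x : ((Metric.sphere (0 : EuclideanSpace ℝ (Fin (1 + 1))) 1)) × ((Metric.sphere (0 : EuclideanSpace ℝ (Fin (3 + 1))) 1))) : (EuclideanSpace ℝ (Fin 5)) :=
  tup5 ((2 + (x.2 : (EuclideanSpace ℝ (Fin 4))) 0) * (x.1 : (EuclideanSpace ℝ (Fin 2))) 0) ((2 + (x.2 : (EuclideanSpace ℝ (Fin 4))) 0) * (x.1 : (EuclideanSpace ℝ (Fin 2))) 1)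
    ((x.2 : (EuclideanSpace ℝ (Fin 4))) 1) ((x.2 : (EuclideanSpace ℝ (Fin 4))) 2) ((x.2 : (EuclideanSpace ℝ (Fin 4))) 3)

/-- `r²(Ψ(c, u)) = (2 + u₀)²`. [folklore] -/
theorem ringFn_embFn (x : ((Metric.sphere (0 : EuclideanSpace ℝ (Fin (1 + 1))) 1)) × ((Metric.sphere (0 : EuclideanSpace ℝ (Fin (3 + 1))) 1))) : ringFn (embFn x) = (2 + (x.2 : (EuclideanSpace ℝ (Fin 4))) 0) ^ 2 := by
  have hc := sq_add_sq_of_mem_sphereOne x.1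
  simp only [ringFn, embFn, tup5_apply_zero, tup5_apply_one]
  nlinarith

/-- `‖Ψ(c, u)‖² = 5 + 4u₀`. [folklore] -/
theorem sqNorm_embFn (x : ((Metric.sphere (0 : EuclideanSpace ℝ (Fin (1 + 1))) 1)) × ((Metric.sphere (0 : EuclideanSpace ℝ (Fin (3 + 1))) 1))) : sqNorm (embFn x) = 5 + 4 * (x.2 : (EuclideanSpace ℝ (Fin 4))) 0 := by
  have hc := sq_add_sq_of_mem_sphereOne x.1
  have hu := sum_sq_of_mem_sphereThree x.2
  simp only [sqNorm, embFn, tup5_apply_zero, tup5_apply_one, tup5_apply_two, tup5_apply_three,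
    tup5_apply_four]
  nlinarith

/-- `Ψ` lands in `T`. [folklore] -/
theorem torusFn_embFn (x : ((Metric.sphere (0 : EuclideanSpace ℝ (Fin (1 + 1))) 1)) × ((Metric.sphere (0 : EuclideanSpace ℝ (Fin (3 + 1))) 1))) : torusFn (embFn x) = 0 := by
  rw [torusFn, sqNorm_embFn, ringFn_embFn]; ring

/-- `Ψ` is smooth. [folklore] -/
theorem contMDiff_embFn : ContMDiff ((𝓡 1).prod (𝓡 3)) 𝓘(ℝ, (EuclideanSpace ℝ (Fin 5))) ∞ embFn := by
  have hc : ContMDiff ((𝓡 1).prod (𝓡 3)) 𝓘(ℝ, (EuclideanSpace ℝ (Fin 2))) ∞ (fun x : ((Metric.sphere (0 : EuclideanSpace ℝ (Fin (1 + 1))) 1)) × ((Metric.sphere (0 : EuclideanSpace ℝ (Fin (3 + 1))) 1)) => (x.1 : (EuclideanSpace ℝ (Fin 2)))) :=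
    (contMDiff_coe_sphere (n := 1)).comp contMDiff_fst
  have hu : ContMDiff ((𝓡 1).prod (𝓡 3)) 𝓘(ℝ, (EuclideanSpace ℝ (Fin 4))) ∞ (fun x : ((Metric.sphere (0 : EuclideanSpace ℝ (Fin (1 + 1))) 1)) × ((Metric.sphere (0 : EuclideanSpace ℝ (Fin (3 + 1))) 1)) => (x.2 : (EuclideanSpace ℝ (Fin 4)))) :=
    (contMDiff_coe_sphere (n := 3)).comp contMDiff_snd
  rw [contMDiff_euclidean_iff] at hc hu
  rw [contMDiff_euclidean_iff]
  intro i
  fin_cases i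
  · simp only [embFn]
    exact (contMDiff_const.add (hu 0)).mul (hc 0)
  · simp only [embFn]
    exact (contMDiff_const.add (hu 0)).mul (hc 1)
  · simpa [embFn] using hu 1
  · simpa [embFn] using hu 2
  · simpa [embFn] using hu 3

/-- `Ψ` as a map into `T`. [folklore] -/
def embT (x : ((Metric.sphere (0 : EuclideanSpace ℝ (Fin (1 + 1))) 1)) × ((Metric.sphere (0 : EuclideanSpace ℝ (Fin (3 + 1))) 1))) : LevelTorus := ⟨embFn x, torusFn_embFn x⟩

/-- `ι (Ψ x) = Ψ x` in `ℝ⁵`. [folklore] -/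
@[simp] theorem ιT_embT (x : ((Metric.sphere (0 : EuclideanSpace ℝ (Fin (1 + 1))) 1)) × ((Metric.sphere (0 : EuclideanSpace ℝ (Fin (3 + 1))) 1))) : ιT (embT x) = embFn x := rfl

/-- `Ψ : 𝕊¹ × 𝕊³ → T` is smooth (its composite with the embedding `T ⊆ ℝ⁵` is). [folklore] -/
theorem contMDiff_embT : ContMDiff ((𝓡 1).prod (𝓡 3)) (𝓡 4) ∞ embT :=
  contMDiff_of_comp_isSmoothEmbedding (RegularLevel.isSmoothEmbedding_incl isRegularLevel_torusFn)
    contMDiff_embFn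

/-- The radius `r = √(p₀² + p₁²)` (smooth where `r > 0`). [folklore] -/
def radius (p : (EuclideanSpace ℝ (Fin 5))) : ℝ := Real.sqrt (ringFn p)

/-- On `T` the radius is positive (`r² ≥ 1`). [folklore] -/
theorem radius_pos_of_torusFn_eq_zero {p : (EuclideanSpace ℝ (Fin 5))} (hp : torusFn p = 0) : 0 < radius p :=
  Real.sqrt_pos.2 (by have := one_le_ringFn_of_torusFn_eq_zero hp; linarith)

/-- `r² = p₀² + p₁²`. [folklore] -/
theorem radius_sq_eq (p : (EuclideanSpace ℝ (Fin 5))) : radius p ^ 2 = ringFn p :=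
  Real.sq_sqrt (ringFn_nonneg p)

/-- The radius is smooth where `r² > 0`. [folklore] -/
theorem contDiffAt_radius {p : (EuclideanSpace ℝ (Fin 5))} (hp : 0 < ringFn p) : ContDiffAt ℝ ∞ radius p :=
  (Real.contDiffAt_sqrt hp.ne').comp p contDiff_ringFn.contDiffAt

/-- **On `T`: `‖p‖² + 3 = 4 r`**, i.e. `(r - 2)² + p₂² + p₃² + p₄² = 1`. [folklore] -/
theorem sqNorm_add_three_eq_of_torusFn_eq_zero {p : (EuclideanSpace ℝ (Fin 5))} (hp : torusFn p = 0) : sqNorm p + 3 = 4 * radius p := by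
  have hr := radius_pos_of_torusFn_eq_zero hp
  have hr2 := radius_sq_eq p
  have hN := sqNorm_nonneg p
  have h : (sqNorm p + 3) ^ 2 = (4 * radius p) ^ 2 := by
    have : torusFn p = 0 := hp
    simp only [torusFn] at this
    nlinarith
  have h4 : 0 ≤ 4 * radius p := by positivity
  nlinarith [sq_nonneg (sqNorm p + 3 - 4 * radius p), sq_nonneg (sqNorm p + 3 + 4 * radius p)]

/-- The circle part `(p₀, p₁) / r` of the inverse map (an ambient formula). [folklore] -/
def circFn (p : (EuclideanSpace ℝ (Fin 5))) : (EuclideanSpace ℝ (Fin 2)) := tup2 (p 0 / radius p) (p 1 / radius p)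

/-- The sphere part `(r - 2, p₂, p₃, p₄)` of the inverse map (an ambient formula). [folklore] -/
def sphFn (p : (EuclideanSpace ℝ (Fin 5))) : (EuclideanSpace ℝ (Fin 4)) := tup4 (radius p - 2) (p 2) (p 3) (p 4)

/-- The circle part of `Θ` lands in the unit circle (`(p₀² + p₁²)/r² = 1`). [folklore] -/
theorem circFn_mem (q : LevelTorus) : circFn (ιT q) ∈ Metric.sphere (0 : (EuclideanSpace ℝ (Fin 2))) 1 := by
  have hp := torusFn_ιT q
  have hr := radius_pos_of_torusFn_eq_zero hp
  have hr2 := radius_sq_eq (ιT q)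
  rw [mem_sphere_zero_iff_norm, EuclideanSpace.norm_eq, Real.sqrt_eq_one, Fin.sum_univ_two]
  simp only [circFn, tup2_apply_zero, tup2_apply_one, Real.norm_eq_abs, sq_abs, div_pow]
  rw [← add_div, hr2, div_eq_one_iff_eq (lt_of_lt_of_le one_pos (one_le_ringFn_of_torusFn_eq_zero hp)).ne']
  rfl

/-- The sphere part of `Θ` lands in the unit `3`-sphere (`(r - 2)² + p₂² + p₃² + p₄² = 1` on `T`). [folklore] -/
theorem sphFn_mem (q : LevelTorus) : sphFn (ιT q) ∈ Metric.sphere (0 : (EuclideanSpace ℝ (Fin 4))) 1 := by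
  have hp := torusFn_ιT q
  have hr := radius_pos_of_torusFn_eq_zero hp
  have hr2 := radius_sq_eq (ιT q)
  have h3 := sqNorm_add_three_eq_of_torusFn_eq_zero hp
  rw [mem_sphere_zero_iff_norm, EuclideanSpace.norm_eq, Real.sqrt_eq_one, Fin.sum_univ_four]
  simp only [sphFn, tup4_apply_zero, tup4_apply_one, tup4_apply_two, tup4_apply_three,
    Real.norm_eq_abs, sq_abs]
  simp only [sqNorm] at h3
  simp only [ringFn] at hr2
  nlinarith

/-- **The inverse map** `Θ(p) = ((p₀, p₁)/r, (r - 2, p₂, p₃, p₄)) : T → 𝕊¹ × 𝕊³`. [folklore] -/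
def projT (q : LevelTorus) : ((Metric.sphere (0 : EuclideanSpace ℝ (Fin (1 + 1))) 1)) × ((Metric.sphere (0 : EuclideanSpace ℝ (Fin (3 + 1))) 1)) :=
  (⟨circFn (ιT q), circFn_mem q⟩, ⟨sphFn (ιT q), sphFn_mem q⟩)

/-- The radius is smooth on `T`. [folklore] -/
theorem contMDiff_radius_ιT : ContMDiff (𝓡 4) 𝓘(ℝ, ℝ) ∞ fun q : LevelTorus => radius (ιT q) :=
  fun q => (contDiffAt_radius (by have := one_le_ringFn_of_torusFn_eq_zero (torusFn_ιT q); linarith)).contMDiffAt.comp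
    q ((RegularLevel.contMDiff_incl isRegularLevel_torusFn) q)

/-- The coordinate functions are smooth on `T`. [folklore] -/
theorem contMDiff_coord_ιT (i : Fin 5) : ContMDiff (𝓡 4) 𝓘(ℝ, ℝ) ∞ fun q : LevelTorus => ιT q i :=
  ((π i).contDiff.contMDiff).comp (RegularLevel.contMDiff_incl isRegularLevel_torusFn)

/-- `Θ` is smooth (coordinatewise smooth ambient formulas, restricted to the spheres by
Mathlib's `ContMDiff.codRestrict_sphere`). [folklore] -/
theorem contMDiff_projT : ContMDiff (𝓡 4) ((𝓡 1).prod (𝓡 3)) ∞ projT := by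
  have hr := contMDiff_radius_ιT
  have hr0 : ∀ q : LevelTorus, radius (ιT q) ≠ 0 := fun q => (radius_pos_of_torusFn_eq_zero (torusFn_ιT q)).ne'
  have hc : ContMDiff (𝓡 4) 𝓘(ℝ, (EuclideanSpace ℝ (Fin 2))) ∞ fun q : LevelTorus => circFn (ιT q) := by
    rw [contMDiff_euclidean_iff]
    intro i
    fin_cases i
    · simp only [circFn]
      exact (contMDiff_coord_ιT 0).div₀ hr hr0
    · simp only [circFn]
      exact (contMDiff_coord_ιT 1).div₀ hr hr0
  have hs : ContMDiff (𝓡 4) 𝓘(ℝ, (EuclideanSpace ℝ (Fin 4))) ∞ fun q : LevelTorus => sphFn (ιT q) := by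
    rw [contMDiff_euclidean_iff]
    intro i
    fin_cases i
    · simpa [sphFn] using hr.sub_const 2
    · simpa [sphFn] using contMDiff_coord_ιT 2
    · simpa [sphFn] using contMDiff_coord_ιT 3
    · simpa [sphFn] using contMDiff_coord_ιT 4
  exact (hc.codRestrict_sphere circFn_mem).prodMk (hs.codRestrict_sphere sphFn_mem)

/-- `Θ ∘ Ψ = id`. [folklore] -/
theorem projT_embT (x : ((Metric.sphere (0 : EuclideanSpace ℝ (Fin (1 + 1))) 1)) × ((Metric.sphere (0 : EuclideanSpace ℝ (Fin (3 + 1))) 1))) : projT (embT x) = x := by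
  obtain ⟨c, u⟩ := x
  have hu0 := neg_one_le_of_mem_sphereThree u
  have hrad : radius (embFn (c, u)) = 2 + (u : (EuclideanSpace ℝ (Fin 4))) 0 := by
    rw [radius, ringFn_embFn, Real.sqrt_sq (by linarith)]
  have h2 : (2 + (u : (EuclideanSpace ℝ (Fin 4))) 0) ≠ 0 := by linarith
  refine Prod.ext (Subtype.ext ?_) (Subtype.ext ?_)
  · ext i
    fin_cases i
    · simp only [projT, ιT_embT, circFn, Fin.zero_eta, Fin.isValue, tup2_apply_zero, hrad]
      simp [embFn, mul_div_cancel_left₀ _ h2]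
    · simp only [projT, ιT_embT, circFn, Fin.mk_one, Fin.isValue, tup2_apply_one, hrad]
      simp [embFn, mul_div_cancel_left₀ _ h2]
  · ext i
    fin_cases i
    · simp only [projT, ιT_embT, sphFn, Fin.zero_eta, Fin.isValue, tup4_apply_zero, hrad]
      ring
    · simp [projT, sphFn, embFn]
    · simp [projT, sphFn, embFn]
    · simp [projT, sphFn, embFn]

/-- `Ψ ∘ Θ = id`. [folklore] -/
theorem embT_projT (q : LevelTorus) : embT (projT q) = q := by
  have hp := torusFn_ιT q
  have hr := (radius_pos_of_torusFn_eq_zero hp).ne'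
  refine Subtype.ext ?_
  change embFn (projT q) = ιT q
  ext i
  fin_cases i <;> simp [embFn, projT, circFn, sphFn, mul_div_cancel₀ _ hr]

/-- **`T ≅ 𝕊¹ × 𝕊³`** (as manifolds with the product model `(𝓡 1).prod (𝓡 3)` on the right):
the round `S¹ × S³ ⊆ ℝ⁵` is diffeomorphic to Mathlib's `𝕊¹ × 𝕊³`. [folklore] -/
def levelTorusDiffeomorph : LevelTorus ≃ₘ⟮𝓡 4, (𝓡 1).prod (𝓡 3)⟯ (((Metric.sphere (0 : EuclideanSpace ℝ (Fin (1 + 1))) 1)) × ((Metric.sphere (0 : EuclideanSpace ℝ (Fin (3 + 1))) 1))) where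
  toFun := projT
  invFun := embT
  left_inv := embT_projT
  right_inv := projT_embT
  contMDiff_toFun := contMDiff_projT
  contMDiff_invFun := contMDiff_embT

/-- **`T ≅ Circle × 𝕊³`** (Mathlib's Lie group `Circle`, `Circle ≅ 𝕊¹` by the tree's
`nonempty_diffeomorph_circle_sphereOne`). [folklore] -/
theorem nonempty_levelTorusDiffeomorph_circle :
    Nonempty (LevelTorus ≃ₘ⟮𝓡 4, (𝓡 1).prod (𝓡 3)⟯ (Circle × ((Metric.sphere (0 : EuclideanSpace ℝ (Fin (3 + 1))) 1)))) := by
  obtain ⟨e⟩ := nonempty_diffeomorph_circle_sphereOne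
  exact ⟨levelTorusDiffeomorph.trans (Diffeomorph.prodCongr e.symm (Diffeomorph.refl _ _ _))⟩

/-- **`T` is orientable**: the tree's recharted, orientable copy `R ≅ Circle × 𝕊³`
(`exists_circleProdSphereThree_euclidean`) is diffeomorphic to `T` with the same model, and
orientability passes along diffeomorphisms (`IsOrientable.of_diffeomorph`). [cite: HirschDT1976, §4.4 p. 101] -/
theorem isOrientable_levelTorus : IsOrientable (𝓡 4) LevelTorus := by
  obtain ⟨R, _, _, _, _, _, _, _, hRo, ⟨Φ⟩⟩ := exists_circleProdSphereThree_euclidean.{0}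
  obtain ⟨Θ⟩ := nonempty_levelTorusDiffeomorph_circle
  exact hRo.of_diffeomorph (Φ.trans Θ.symm) (by simp)

/-! ### §8 A self-indexing Morse function of type `(1, 1, 0, 1, 1)` on `T ≅ S¹ × S³` -/

/-- **`S¹ × S³` carries a self-indexing Morse function with exactly one critical point of each
of the indices `0, 1, 3, 4` and none of index `2`** (on the round model `T`): the height `p₀`
(`isMorse_heightT`, `ncard_criticalSetOfIndex_heightT`) rearranged by Milnor's Thm. 4.8 (the
tree's discharged `exists_isSelfIndexing_criticalSet_eq_holds`, which keeps the critical points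
and their indices). Classically: the handle decomposition `S¹ × S³ = h⁰ ∪ h¹ ∪ h³ ∪ h⁴`
(Kirby 1989, Ch. I §2, p. 8). [cite: MilnorHCobordism1965, Thm. 4.8 (alternate version) and Def. 4.9]
[cite: Kirby1989, Ch. I §2, p. 8] -/
theorem exists_isSelfIndexing_levelTorus :
    ∃ g : LevelTorus → ℝ, IsMorse (𝓡 4) g ∧ IsSelfIndexing (𝓡 4) g ∧
      (criticalSetOfIndex (𝓡 4) g 0).ncard = 1 ∧ (criticalSetOfIndex (𝓡 4) g 1).ncard = 1 ∧
      (criticalSetOfIndex (𝓡 4) g 2).ncard = 0 ∧ (criticalSetOfIndex (𝓡 4) g 3).ncard = 1 ∧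
      (criticalSetOfIndex (𝓡 4) g 4).ncard = 1 := by
  obtain ⟨g, hg, hsi, hcrit, hind⟩ :=
    exists_isSelfIndexing_criticalSet_eq_holds 4 LevelTorus heightT isMorse_heightT
  obtain ⟨h0, h1, h2, h3, h4⟩ := ncard_criticalSetOfIndex_heightT
  refine ⟨g, hg, hsi, ?_, ?_, ?_, ?_, ?_⟩ <;> rw [ncard_criticalSetOfIndex_congr hcrit hind] <;>
    assumption

end RoundCircleProdSphereThree

end Literature.Topology.FourManifolds

end
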